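import Mathlib
import HarnessLib
import Literature.MathematicalPhysics.QuantumFieldTheory.Balaban1983to89.T3HeightwiseDensityBounds
import Summits.QuantumFields.YangMills.Theses.GuardedThresholdRemoval

/-!
# Route `GuardedThresholdRemoval`: the crux `UnitLawCollarDominated` (stmt-QuantumFields-28045) from the height-0 stability schema

SAME-WALL BRIDGE (LINE g7-B of ideator seat ym-idea-1, price P1 of the critic of record idea-crit-4 g5, whose kernel-checked
scratch `g7b_UnitLawCollarDominated_of_HeightwiseUpperBound.lean` this file lands verbatim).  The crux
`UnitLawCollarDominated` — K-uniform domination of the unit laws `unitLaw_K` by product Haar on a collar of the guard spheres of the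
printed averaging — is implied by the HEIGHT-0 instance of the tree's hypothesis schema
`T3HeightwiseDensityBounds.HeightwiseUpperBound F γ` («`Z_K⁻¹ ρ_{K−n} ≤ C_n` a.e., uniformly in `K`», [Balaban1985UV3]
(5)-upper ÷ (6), Thm 1), assumed uniformly in `0 < γ ≤ γ₂`: with `K₀ = 0`, ANY collar width (`η₀ = 1`) and the GLOBAL constant.
Proof: `unitLaw_eq_map_unitA` + `unitA_comp_descendTo` (`A_K = A_0 ∘ D_{0,K}`) + `map_descendTo_le_smul_fieldMeasure` at height `0`
+ `measurePreserving_unitShift F 0`; then read the measure inequality on the set `S`.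

CONSEQUENCE FOR STAFFING.  28045 is the law form of the height-0 UV-stability upper bound — the same wall as the Balaban3D cell's
construction statement for the pinned `ℰp` tower and as the compactness input of route `UVClassRigidity` (crux 26905); any landing of
`∃ γ₂ > 0, ∀ F γ ≤ γ₂, HeightwiseUpperBound F γ` closes 28045, hence `GuardSphereThin` (28025) via the landed split glue
(`guardSphereThin_of_collar`, `guardedThresholdRemoval_guardCollarHaarSmall_proof`), by modus ponens.

No summit statement and no rung is proved here; R3 (`YM3TorusSU2`) stays open on 28045 and the print-shape trunk 28027.
-/

open Summit.QuantumFields.YangMills.Theses.GuardedThresholdRemoval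
open Literature.MathematicalPhysics.QuantumFieldTheory.Balaban1983to89
open Literature.MathematicalPhysics.QuantumFieldTheory.Balaban1983to89.T3ContinuumYM3Torus
open Literature.MathematicalPhysics.QuantumFieldTheory.Balaban1983to89.T3UnitLawDensityEML
open Literature.MathematicalPhysics.QuantumFieldTheory.Balaban1983to89.T3HeightwiseDensityBounds
open Literature.MathematicalPhysics.QuantumFieldTheory.Balaban1983to89.T3UnitScaleTilt
open Literature.MathematicalPhysics.QuantumFieldTheory.Balaban1983to89.T3TiltDescent
open Literature.MathematicalPhysics.QuantumFieldTheory.Balaban1983to89.T3LevelShift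
open MeasureTheory

namespace Summit.QuantumFields.YangMills.Theorems.GuardedThresholdRemovalCollarOfHeightwise

/-- ★ **THE CRUX FROM THE HEIGHT-0 STABILITY SCHEMA**: a `γ`-uniform family of height-wise upper bounds
`HeightwiseUpperBound F γ` (`0 < γ ≤ γ₂`) implies `UnitLawCollarDominated` (with `K₀ = 0`, `η₀ = 1` and the global constant).
[cite: Balaban1985UV3, (5)–(6), Thm 1 p.257] (reduction: idea-crit-4 g5; landed by ym-idea-1 g7) -/
theorem unitLawCollarDominated_of_heightwiseUpperBound
    (h : ∃ γ₂ : ℝ, 0 < γ₂ ∧ ∀ (F : T3Family) (γ : ℝ), 0 < γ → γ ≤ γ₂ → HeightwiseUpperBound F γ) :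
    UnitLawCollarDominated := by
  obtain ⟨γ₂, hγ₂, hH⟩ := h
  refine ⟨γ₂, hγ₂, fun F γ hγ hle => ⟨1, one_pos, ?_⟩⟩
  obtain ⟨C, hC0, hdom⟩ := map_descendTo_le_smul_fieldMeasure (F := F) (γ := γ) hγ.le (hH F γ hγ hle) 0
  refine ⟨C, 0, fun K _ S _ => ?_⟩
  have hK : 0 ≤ K := Nat.zero_le K
  -- the unit law of run K is the image under `unitA 0` of the descended run law at height 0
  have hmeasA : Measurable (unitA F ℰp 0 : GaugeField (F.P 0) 0 (Matrix.specialUnitaryGroup (Fin 2) ℂ) → _) :=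
    measurable_unitA F ℰp measurableE_ℰp 0
  have hmeasD := measurable_descendTo F ℰp measurableE_ℰp hK (G := Matrix.specialUnitaryGroup (Fin 2) ℂ)
  have hlaw : F.unitLaw ℰp measurableE_ℰp γ K =
      Measure.map (unitA F ℰp 0) (Measure.map (descendTo F ℰp 0 K hK) (gibbsK F ℰp γ K)) := by
    rw [unitLaw_eq_map_unitA, Measure.map_map hmeasA hmeasD, unitA_comp_descendTo]
  -- `unitA 0 = unitShift F 0 ∘ iter 0 = unitShift F 0`, which preserves product Haar
  have hA0 : (unitA F ℰp 0 : GaugeField (F.P 0) 0 (Matrix.specialUnitaryGroup (Fin 2) ℂ) → _) = unitShift F 0 := by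
    funext U; rfl
  have hpres : Measure.map (unitA F ℰp 0) (fieldMeasure (F.P 0) 0 (Matrix.specialUnitaryGroup (Fin 2) ℂ)) =
      fieldMeasure (F.P 0) 0 (Matrix.specialUnitaryGroup (Fin 2) ℂ) := by
    rw [hA0]; exact (measurePreserving_unitShift (G := Matrix.specialUnitaryGroup (Fin 2) ℂ) F 0).map_eq
  -- domination transported
  have hle : F.unitLaw ℰp measurableE_ℰp γ K ≤ ENNReal.ofReal C • fieldMeasure (F.P 0) 0 (Matrix.specialUnitaryGroup (Fin 2) ℂ) := by
    rw [hlaw, ← hpres, ← Measure.map_smul]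
    exact Measure.map_mono (hdom K hK) hmeasA
  -- read on the set S (outer measures are monotone in the measure)
  have hS : F.unitLaw ℰp measurableE_ℰp γ K S ≤ (ENNReal.ofReal C • fieldMeasure (F.P 0) 0 (Matrix.specialUnitaryGroup (Fin 2) ℂ)) S :=
    Measure.le_iff'.1 hle S
  rw [Measure.smul_apply, smul_eq_mul] at hS
  have hfin : ENNReal.ofReal C * fieldMeasure (F.P 0) 0 (Matrix.specialUnitaryGroup (Fin 2) ℂ) S ≠ ⊤ :=
    ENNReal.mul_ne_top ENNReal.ofReal_ne_top (measure_ne_top _ _)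
  calc (F.unitLaw ℰp measurableE_ℰp γ K).real S
      = (F.unitLaw ℰp measurableE_ℰp γ K S).toReal := rfl
    _ ≤ (ENNReal.ofReal C * fieldMeasure (F.P 0) 0 (Matrix.specialUnitaryGroup (Fin 2) ℂ) S).toReal :=
        ENNReal.toReal_mono hfin hS
    _ = C * (fieldMeasure (F.P 0) 0 (Matrix.specialUnitaryGroup (Fin 2) ℂ)).real S := by
        rw [ENNReal.toReal_mul, ENNReal.toReal_ofReal hC0]; rfl

end Summit.QuantumFields.YangMills.Theorems.GuardedThresholdRemovalCollarOfHeightwise
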